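import Literature.NumberTheory.Sieve.PolynomialCongruences
import HarnessLib

/-!
# Homma 2008: a rate, uniform in the frequency, for the Weyl sums over roots of a quadratic
# congruence to prime moduli (negative discriminant)

Topic `Literature/NumberTheory/Sieve`.  ONE named fact (published, not proved here); no
definitions.

K. Homma, *On the discrepancy of uniformly distributed roots of quadratic congruences*, J. Number
Theory 128 (2008) 500–508, considers an irreducible quadratic `f(X) = aX² + bX + c ∈ ℤ[X]` with
discriminant `D = b² − 4ac < 0` and the Weyl sums `ρ_h(n) = ∑_{f(ν) ≡ 0 (n)} e(hν/n)` ((5); the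
tree's `polyRootWeylSum f n h`).  Duke–Friedlander–Iwaniec (1995) give `∑_{p ≤ x} ρ_h(p) = o(π(x))`
for each fixed `h ≠ 0` (tree: `dukeFriedlanderIwaniecToth_quadraticRoots_primeModuli`, and the
architecture `DFI1995.*` in `QuadraticRootsPrimeModuliDFI*.lean`), with NO rate: their sieve for
complex sequences (Theorem 5) is applied with a fixed `ε`.  Homma modifies that sieve (Lemma 1,
p. 503: level `x^{1/2}(log x)^{−B}` in (ii), `(log x)^{−4}` in the bilinear hypothesis (iii),
conclusion `∑_{p ≤ x} a_p(h) ≪ (C₁(h) + C₂(h)) x (log x)^{−2} (log log x)^B`) and feeds it with the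
`h`-uniform Duke–Friedlander–Iwaniec bound (Theorem 1, p. 504:
`L_{d,h}(x) ≪ x^{1/2} + d^{−1/2}(h,d)^{1/4} x^{3/4} τ(dh)² (log x)²` for `1 ≤ h ≤ x`) to get

**Lemma 2 (p. 504).** `∑_{p ≤ x} ρ_h(p) ≪ x (log x)^{−2} (log log x)^{19} h^{1/8} τ(h)`, where the
implied constant depends only on `a, b, D`.

(whence the Main Theorem, p. 502: discrepancy `≪ ((log log x)^{19}/log x)^α π(x)` for every
`α < 8/9`, via Erdős–Turán; not vendored — it needs a discrepancy definition the tree does not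
have).  This is ONE logarithm saved over the trivial bound `2π(x)`, polynomially in `h` — the only
RATE in print for these prime-moduli Weyl sums (Tóth 2000, positive discriminant, concludes through
the same `ε`-sieve and states no rate; Homma p. 502 "we do not expect a similar or better estimate
… in this positive discriminant case").

Grounds `Summit.Parity.BatemanHorn.Theses.LambertRoots.MuRootWeyl` (stmt-Parity-16279) and
`…LambertRoots.NearWindow` (stmt-Parity-16278): those ask for `∏μ(d_i) log d_i`-twisted joint-root
Weyl sums over ALL moduli with an ARBITRARY log-power saving `(log D)^{−A}` in the range
`|j| ≤ (log D)^B` — STRONGER than anything printed (different weights: `μ·log` on all moduli vs.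
primes; arbitrary `A` vs. one logarithm; every irreducible degree vs. quadratic `D < 0`); this fact
is the nearest printed statement and answers the route's "cheapest falsifier (i)" (a log-power
rate polynomial in `h` IS in print, for `D < 0` only).

Quantifier reading of `≪` (constant depending only on `a, b, D`): there are `K` and `x₀`,
independent of `h`, such that the bound holds for all integers `x ≥ x₀` and `1 ≤ h ≤ x` (the
range of Theorem 1 used in the proof; for larger `h` the bound exceeds the trivial one).  Taking
`x₀` existential (rather than `x ≥ e^{12}` of Lemma 1) and integer `x` is implied by the printed
statement.  `τ(h) = #(Nat.divisors h)`; `(log x)^{−2}` is written `((log x)⁻¹)²`.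

## References

* K. Homma, J. Number Theory 128 (2008) 500–508: (5) p. 501, Lemma 1 p. 503, Theorem 1 and
  Lemma 2 p. 504, §3 p. 507 (Main Theorem p. 502). [Homma2008] (held:
  `paper:doi-10-1016-j-jnt-2007-09-003`, pp. 1–8 read 2026-08-16)
* W. Duke, J. B. Friedlander, H. Iwaniec, Ann. of Math. 141 (1995) 423–441 (Theorem p. 424:
  the `o(π(x))` form). [DukeFriedlanderIwaniec1995]
-/

namespace Literature.NumberTheory.Sieve

open scoped BigOperators Polynomial
open Polynomial

/-- **Homma 2008, Lemma 2** (J. Number Theory 128, p. 504): for an irreducible quadratic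
`f = aX² + bX + c ∈ ℤ[X]` with negative discriminant `b² − 4ac < 0`,
`∑_{p ≤ x} ρ_h(p) ≪ x (log x)^{−2} (log log x)^{19} h^{1/8} τ(h)` with an implied constant
depending only on `f` (uniform in `h`); here `ρ_h(p) = polyRootWeylSum f p h =
∑_{ν mod p, f(ν) ≡ 0} e(hν/p)`, read for integers `x ≥ x₀` and `1 ≤ h ≤ x`.  One logarithm below
the trivial bound, polynomially in `h`: the only printed rate for these sums (DFI 1995 / Tóth 2000
give `o(π(x))` for fixed `h`).  Grounds `Summit.Parity.BatemanHorn.Theses.LambertRoots.MuRootWeyl`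
and `…NearWindow`, which are STRONGER (μ·log weights on all moduli, arbitrary log-power saving,
all degrees). [cite: Homma2008, Lemma 2] -/
def homma2008_lemma2 : Prop :=
  ∀ f : ℤ[X], f.natDegree = 2 → Irreducible f →
    (f.coeff 1) ^ 2 - 4 * f.coeff 2 * f.coeff 0 < 0 →
    ∃ K : ℝ, ∃ x₀ : ℕ, ∀ x : ℕ, x₀ ≤ x → ∀ h : ℕ, 1 ≤ h → h ≤ x →
      ‖∑ p ∈ Nat.primesLE x, polyRootWeylSum f p h‖ ≤
        K * (x : ℝ) * (Real.log x)⁻¹ ^ 2 * Real.log (Real.log x) ^ 19 *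
          (h : ℝ) ^ (1 / 8 : ℝ) * ((Nat.divisors h).card : ℝ)

end Literature.NumberTheory.Sieve
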